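import Literature.Probability.RandomPlanarGeometry.ChordalBoundary
import HarnessLib

/-!
# Boundary correspondence of a chordal map: sub-arcs inside the period window, and a datum towards `pt 3`

Topic `Probability/RandomPlanarGeometry`; theorems only. Complements `ChordalBoundary.lean`
(which treats, for a conformal rectangle `R = (Ω; p₀, p₁, p₂, p₃)` and a chordal map
`ψ : ℍₒ → Ω` of `(Ω; p₀, p₂)`, the two arcs ADJACENT to the target `p₂`, which pull back to real
rays) by the bookkeeping needed for the second configuration of the splitting form of locality
(Lawler–Schramm–Werner (2001), Cor. 2.3), where the relevant arc is NOT adjacent to the target: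

* `ConformalRectangle.boundaryExtension_mem_image_Icc_iff_uIcc` — a closed sub-arc
  `boundary '' [α, β]` with `mark 2 - 1 < α ≤ β < mark 2` pulls back under the boundary extension
  `Ψ` (on the closed half-plane) to the compact real segment between `discParam α` and
  `discParam β` (`discParam` the pulled-back parametrisation of `ChordalBoundary`);
* `ConformalRectangle.hasBoundaryValue_discParam_of_mem_Ioo`, `discParam_order_of_mem_Ioo` — the
  boundary values and the order of the pulled-back parameters between `mark 0` and `mark 1`;
* `ConformalRectangle.exists_isUniformizing_crossRatio_eq_div` — if `ψ` has boundary values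
  `p₀, p₁, p₂` at `0, v₁, v₂` and `p₃` at `∞` (`0 < v₁ < v₂` or `v₂ < v₁ < 0`) then `R` has a
  uniformizing datum of cross-ratio `v₁/v₂` (an explicit real Möbius precomposition);
* `MarkedDomain.arc_one_three` — the closed arc `[p₁, p₂]` of a three-marked domain.

The window lemmas and the datum are adapted (arbitrary sub-arcs; target parameter `mark 2`) from
the Summit-side file
`Summits/CriticalPhenomena/CardyFormulaZ2/Theorems/CardyComplexConeSLESixFamiliesGiveCardySleSideTouchPart2.lean`,
which Literature files cannot import. References: Ch. Pommerenke, *Boundary Behaviour of Conformal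
Maps* (1992), Thm. 2.6; L. V. Ahlfors, *Complex Analysis* (1979), Ch. 3 §3 (cross-ratio, linear
fractional maps); W. Werner (2007), §3.
-/

noncomputable section

open Set Filter Topology MeasureTheory Complex Metric
open UpperHalfPlane (upperHalfPlaneSet)
open scoped NNReal ENNReal unitInterval

namespace Literature.Probability.RandomPlanarGeometry

/-! ### Three-marked domains -/

namespace MarkedDomain

variable {D : MarkedDomain 3}

/-- The next mark after `mark 1` in a three-marked domain is `mark 2`. [folklore] -/
theorem nextMark_one_three : D.nextMark 1 = D.mark 2 := by
  simp only [MarkedDomain.nextMark]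
  rfl

/-- The closed arc `[p₁, p₂]` of a three-marked domain is `boundary '' [mark 1, mark 2]`.
[folklore] -/
theorem arc_one_three : D.arc 1 = D.boundary '' Icc (D.mark 1) (D.mark 2) := by
  rw [MarkedDomain.arc, nextMark_one_three]

end MarkedDomain

/-! ### Boundary correspondence of a chordal map inside the period window -/

namespace ConformalRectangle

variable {R : ConformalRectangle} {ψ : ConformalEquiv upperHalfPlaneSet R.carrier} {Φ : ℂ → ℂ}
  (h : JordanDomain.IsDiscExtension R.toJordanDomain ψ Φ)
  (h₂ : ψ.HasBoundaryValueAtInfty (R.pt 2))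

section Window

include h h₂

/-- `ψ` has boundary value `boundary t` at `discParam t`, for `t` in the period window
`(mark 2 - 1, mark 2)`. [folklore] -/
theorem hasBoundaryValue_discParam_of_mem_Ioo {t : ℝ} (ht : t ∈ Ioo (R.mark 2 - 1) (R.mark 2)) :
    ψ.HasBoundaryValue (JordanDomain.discParam R.toJordanDomain Φ t) (R.boundary t) := by
  have h1 := h.tendsto_nhdsWithin (z := (JordanDomain.discParam R.toJordanDomain Φ t : ℂ)) (by simp)
  rwa [h.boundaryExtension_discParam (boundary_ne_apply_one h h₂ ht)] at h1

omit h h₂ in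
/-- Inside the period window, `boundary t ∈ boundary '' [α, β]` iff `t ∈ [α, β]`
(`mark 2 - 1 < α`, `β < mark 2`). [folklore] -/
theorem boundary_mem_image_Icc_iff_of_mem_Ioo {α β t : ℝ} (hα : R.mark 2 - 1 < α) (hβ : β < R.mark 2)
    (ht : t ∈ Ioo (R.mark 2 - 1) (R.mark 2)) :
    R.boundary t ∈ R.boundary '' Icc α β ↔ t ∈ Icc α β := by
  -- adapted from Summits/…/CardyComplexConeSLESixFamiliesGiveCardySleSideTouchPart2.lean
  refine ⟨?_, fun hmem ↦ ⟨t, hmem, rfl⟩⟩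
  rintro ⟨t', ht', heq⟩
  have := R.injOn_boundary_Ico (R.mark 2 - 1) ⟨by linarith [ht'.1], by linarith [ht'.2]⟩
    ⟨ht.1.le, by linarith [ht.2]⟩ heq
  rw [← this]
  exact ht'

/-- The image of `[α, β] ⊆ (mark 2 - 1, mark 2)` under the pulled-back parametrisation is the
compact segment between `discParam α` and `discParam β`. [folklore] -/
theorem image_discParam_Icc_eq_uIcc {α β : ℝ} (hα : R.mark 2 - 1 < α) (hαβ : α ≤ β) (hβ : β < R.mark 2) :
    JordanDomain.discParam R.toJordanDomain Φ '' Icc α β =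
      uIcc (JordanDomain.discParam R.toJordanDomain Φ α)
        (JordanDomain.discParam R.toJordanDomain Φ β) := by
  have hsub : uIcc α β ⊆ Ioo (R.mark 2 - 1) (R.mark 2) := by
    rw [uIcc_of_le hαβ]
    exact fun t ht ↦ ⟨hα.trans_le ht.1, ht.2.trans_lt hβ⟩
  rw [← uIcc_of_le hαβ]
  refine Subset.antisymm ?_
    (intermediate_value_uIcc ((continuousOn_discParam_Ioo h h₂).mono hsub))
  rcases strictMonoOn_or_strictAntiOn_discParam h h₂ with hg | hg
  · exact ((hg.mono hsub).monotoneOn).image_uIcc_subset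
  · exact ((hg.mono hsub).antitoneOn).image_uIcc_subset

/-- **A closed sub-arc inside the period window pulls back to a compact real segment.** For
`im z ≥ 0` and `mark 2 - 1 < α ≤ β < mark 2`: `Ψ z ∈ boundary '' [α, β]` iff `z` is real with
`re z` between `discParam α` and `discParam β`. [folklore] -/
theorem boundaryExtension_mem_image_Icc_iff_uIcc {α β : ℝ} (hα : R.mark 2 - 1 < α) (hαβ : α ≤ β)
    (hβ : β < R.mark 2) {z : ℂ} (hz : 0 ≤ z.im) :
    ψ.boundaryExtension z ∈ R.boundary '' Icc α β ↔
      z.im = 0 ∧ z.re ∈ uIcc (JordanDomain.discParam R.toJordanDomain Φ α)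
        (JordanDomain.discParam R.toJordanDomain Φ β) := by
  -- adapted from Summits/…/CardyComplexConeSLESixFamiliesGiveCardySleSideTouchPart2.lean
  have hzre : z.im = 0 → z = ((z.re : ℝ) : ℂ) := fun him ↦ Complex.ext (by simp) (by simp [him])
  obtain ⟨t, ht, hbt, hgt⟩ := exists_mem_Ioo_discParam_eq h h₂ z.re
  rw [← image_discParam_Icc_eq_uIcc h h₂ hα hαβ hβ]
  constructor
  · intro hmem
    have him : z.im = 0 := JordanDomain.im_eq_zero_of_boundaryExtension_mem_frontier ψ hz
      (by obtain ⟨s, -, hs⟩ := hmem; rw [← hs]; exact R.boundary_mem_frontier s)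
    refine ⟨him, ?_⟩
    rw [hzre him, ← hbt, boundary_mem_image_Icc_iff_of_mem_Ioo hα hβ ht] at hmem
    exact ⟨t, hmem, hgt⟩
  · rintro ⟨him, t', ht', hgt'⟩
    have ht'W : t' ∈ Ioo (R.mark 2 - 1) (R.mark 2) := ⟨hα.trans_le ht'.1, ht'.2.trans_lt hβ⟩
    have htt' : t' = t := injOn_discParam_Ioo h h₂ ht'W ht (hgt'.trans hgt.symm)
    rw [hzre him, ← hbt, boundary_mem_image_Icc_iff_of_mem_Ioo hα hβ ht, ← htt']
    exact ht'

/-- **Order of the pulled-back parameters between `mark 0` and `mark 1`.** If `ψ` has boundary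
value `pt 0` at `0`, then for `mark 0 < t < mark 1` the points `discParam t`, `discParam (mark 1)`
satisfy `0 < discParam t < discParam (mark 1)` (parametrisation increasing) or
`discParam (mark 1) < discParam t < 0` (decreasing). [folklore] -/
theorem discParam_order_of_mem_Ioo (h₀ : ψ.HasBoundaryValue 0 (R.pt 0)) {t : ℝ}
    (ht : t ∈ Ioo (R.mark 0) (R.mark 1)) :
    0 < JordanDomain.discParam R.toJordanDomain Φ t ∧
        JordanDomain.discParam R.toJordanDomain Φ t <
          JordanDomain.discParam R.toJordanDomain Φ (R.mark 1) ∨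
      JordanDomain.discParam R.toJordanDomain Φ (R.mark 1) <
          JordanDomain.discParam R.toJordanDomain Φ t ∧
        JordanDomain.discParam R.toJordanDomain Φ t < 0 := by
  have hg0 := discParam_mark_zero h h₀
  have htW : t ∈ Ioo (R.mark 2 - 1) (R.mark 2) :=
    ⟨R.mark_zero_mem_Ioo.1.trans ht.1, ht.2.trans R.mark_one_mem_Ioo.2⟩
  rcases strictMonoOn_or_strictAntiOn_discParam h h₂ with hg | hg
  · exact Or.inl ⟨hg0 ▸ hg R.mark_zero_mem_Ioo htW ht.1, hg htW R.mark_one_mem_Ioo ht.2⟩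
  · exact Or.inr ⟨hg htW R.mark_one_mem_Ioo ht.2, hg0 ▸ hg R.mark_zero_mem_Ioo htW ht.1⟩

end Window

/-! ### A uniformizing datum from a chordal map towards `pt 3` -/

omit h h₂ in
/-- Cardy's cross-ratio of `(0, s, 1/2, 1)` is `s/(1 - s)`. [folklore] -/
theorem crossRatio_tuple_zero_half_one {s : ℝ} (hs : s ≠ 1) : crossRatio ![0, s, 1 / 2, 1] = s / (1 - s) := by
  have h1 : (1 : ℝ) - s ≠ 0 := sub_ne_zero.2 (Ne.symm hs)
  simp only [crossRatio, Matrix.cons_val_zero, Matrix.cons_val_one, Matrix.cons_val]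
  rw [div_eq_div_iff (mul_ne_zero (by norm_num) (sub_ne_zero.2 hs)) h1]
  ring

/-- **A uniformizing datum from a chordal map of `(Ω; p₀, p₃)`.** If `ψ : ℍₒ → Ω` has boundary
values `p₀` at `0`, `p₁` at `v₁`, `p₂` at `v₂` and `p₃` at `∞`, where `0 < v₁ < v₂` or
`v₂ < v₁ < 0`, then `R = (Ω; p₀, p₁, p₂, p₃)` has a uniformizing datum of cross-ratio `v₁/v₂`
(precompose `ψ` with the real Möbius map `z ↦ ±v₂ z/(1 ∓ z)` and take
`x = ±(0, v₁/(v₁+v₂), 1/2, 1)`; Ahlfors (1979), Ch. 3 §3). [cite: Ahlfors1979, Ch. 3 §3.1] -/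
theorem exists_isUniformizing_crossRatio_eq_div (ψ : ConformalEquiv upperHalfPlaneSet R.carrier)
    {v₁ v₂ : ℝ} (h₀ : ψ.HasBoundaryValue 0 (R.pt 0))
    (hv₁ : ψ.HasBoundaryValue v₁ (R.pt 1)) (hv₂ : ψ.HasBoundaryValue v₂ (R.pt 2))
    (h₃ : ψ.HasBoundaryValueAtInfty (R.pt 3)) (hsign : 0 < v₁ ∧ v₁ < v₂ ∨ v₂ < v₁ ∧ v₁ < 0) :
    ∃ (φ₀ : ConformalEquiv upperHalfPlaneSet R.carrier) (x : Fin 4 → ℝ), R.IsUniformizing φ₀ x ∧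
      crossRatio x = v₁ / v₂ := by
  -- adapted from Summits/…/CardyComplexConeSLESixFamiliesGiveCardySleSideTouchPart2.lean
  set s : ℝ := v₁ / (v₁ + v₂) with hs
  have hden : v₁ + v₂ ≠ 0 := by rcases hsign with ⟨h, h'⟩ | ⟨h, h'⟩ <;> intro hh <;> linarith
  have hs0 : 0 < s := by
    rcases hsign with ⟨h, h'⟩ | ⟨h, h'⟩
    · exact div_pos h (by linarith)
    · exact div_pos_of_neg_of_neg h' (by linarith)
  have hs2 : s < 1 / 2 := by
    rcases hsign with ⟨h, h'⟩ | ⟨h, h'⟩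
    · rw [hs, div_lt_iff₀ (by linarith)]; linarith
    · rw [hs, div_lt_iff_of_neg (by linarith)]; linarith
  have hbase : StrictMono ![(0 : ℝ), s, 1 / 2, 1] := by
    refine Fin.strictMono_iff_lt_succ.2 fun i ↦ ?_
    fin_cases i
    · exact hs0
    · exact hs2
    · show (1 / 2 : ℝ) < 1; norm_num
  have hcr : crossRatio ![(0 : ℝ), s, 1 / 2, 1] = v₁ / v₂ := by
    have hv₂0 : v₂ ≠ 0 := by rcases hsign with ⟨h, h'⟩ | ⟨h, h'⟩ <;> intro hh <;> linarith
    rw [crossRatio_tuple_zero_half_one (by linarith), hs, div_eq_div_iff ?_ hv₂0]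
    · field_simp; ring
    · rw [show 1 - v₁ / (v₁ + v₂) = v₂ / (v₁ + v₂) by field_simp; ring]
      exact div_ne_zero hv₂0 hden
  -- the value of the Möbius map at `±s` is `v₁`
  have hMs : ∀ ε : ℝ, ε * ε = 1 → (ε * v₂ * (ε * s) + 0) / (-ε * (ε * s) + 1) = v₁ := by
    intro ε hε
    have hden' : -ε * (ε * s) + 1 ≠ 0 := by
      have : -ε * (ε * s) + 1 = 1 - s := by linear_combination (-s) * hε
      rw [this]; linarith
    rw [div_eq_iff hden', hs]
    field_simp
    linear_combination (v₂ * v₁ + v₁ * v₁) * hε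
  rcases hsign with ⟨h1, h12⟩ | ⟨h21, h1⟩
  · -- `0 < v₁ < v₂`: pole at `1`
    have hdet : 0 < v₂ * 1 - 0 * (-1) := by linarith
    refine ⟨(ConformalEquiv.realMobius v₂ 0 (-1) 1 hdet).trans ψ, ![0, s, 1 / 2, 1],
      isUniformizing_of_hasBoundaryValue (Or.inl hbase) ?_ ?_ ?_ ?_, hcr⟩
    · refine ConformalEquiv.hasBoundaryValue_realMobius_trans hdet ψ (x := 0) (by norm_num) ?_
      rw [show (v₂ * 0 + 0) / (-1 * 0 + 1) = (0 : ℝ) by ring]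
      exact_mod_cast h₀
    · refine ConformalEquiv.hasBoundaryValue_realMobius_trans hdet ψ (x := s)
        (by intro hh; linarith) ?_
      rw [show (v₂ * s + 0) / (-1 * s + 1) = (1 * v₂ * (1 * s) + 0) / (-1 * (1 * s) + 1) by ring,
        hMs 1 (by norm_num)]
      exact hv₁
    · refine ConformalEquiv.hasBoundaryValue_realMobius_trans hdet ψ (x := 1 / 2) (by norm_num) ?_
      rw [show (v₂ * (1 / 2) + 0) / (-1 * (1 / 2) + 1) = v₂ by ring]
      exact hv₂
    · exact ConformalEquiv.hasBoundaryValue_realMobius_trans_pole hdet ψ (x := 1) (by norm_num) h₃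
  · -- `v₂ < v₁ < 0`: pole at `-1`, antitone tuple
    have hdet : 0 < -v₂ * 1 - 0 * 1 := by linarith
    refine ⟨(ConformalEquiv.realMobius (-v₂) 0 1 1 hdet).trans ψ, fun i ↦ -(![0, s, 1 / 2, 1] i),
      isUniformizing_of_hasBoundaryValue (Or.inr hbase.neg) ?_ ?_ ?_ ?_, ?_⟩
    · refine ConformalEquiv.hasBoundaryValue_realMobius_trans hdet ψ (x := -0) (by norm_num) ?_
      rw [show (-v₂ * -0 + 0) / (1 * -0 + 1) = (0 : ℝ) by ring]
      exact_mod_cast h₀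
    · refine ConformalEquiv.hasBoundaryValue_realMobius_trans hdet ψ (x := -s)
        (by intro hh; linarith) ?_
      rw [show (-v₂ * -s + 0) / (1 * -s + 1) = (-1 * v₂ * (-1 * s) + 0) / (- -1 * (-1 * s) + 1) by
        ring, hMs (-1) (by norm_num)]
      exact hv₁
    · refine ConformalEquiv.hasBoundaryValue_realMobius_trans hdet ψ (x := -(1 / 2)) (by norm_num) ?_
      rw [show (-v₂ * -(1 / 2) + 0) / (1 * -(1 / 2) + 1) = v₂ by ring]
      exact hv₂
    · exact ConformalEquiv.hasBoundaryValue_realMobius_trans_pole hdet ψ (x := -1) (by norm_num) h₃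
    · rw [show (fun i ↦ -(![(0 : ℝ), s, 1 / 2, 1] i)) = -![(0 : ℝ), s, 1 / 2, 1] from rfl,
        crossRatio_neg, hcr]

end ConformalRectangle

end Literature.Probability.RandomPlanarGeometry
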